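import Summits.BirchSwinnertonDyer.BirchSwinnertonDyer.Theorems.QuadraticBranchSignedControlPlusKatoDivisibilityOfEulerSystemBound
import Literature.NumberTheory.EllipticCurves.Kato2004.IwasawaH1LambdaTorsionFreeProofs
import HarnessLib

/-!
# K8 crux 20445 `PlusKatoDivisibilityBranchOnto` — lane B hardening (g7), part 2: on the pin, Kobayashi
# Thm. 7.3 i) («`Col⁺ ∘ loc` is injective on `𝐇¹(T)`», the FIELD `colPlus_injective` of the held package
# hZ) is EQUIVALENT to the upper half of Kato Thm. 12.4 (2) («`rank_Λ 𝐇¹_Γ(T_pW) ≤ 1`»), and hZ by itself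
# yields Kato's `rank_Λ 𝐇¹_Γ(T_pW) = 1` for every twist model `W` (proofs only)

Cell `bsd-potss` (HOME `run/shared/lean/pub/bsd-potss/`), seat `bsd-potss-k8q-c2x` g7 (prover; WIDTH-LEVER
lane B of the K8 Kato side, route `QuadraticBranchSignedControl`, crux stmt-BirchSwinnertonDyer-20445 with
held aliases 21362 = hZ = `Kobayashi2003.thm62_63_73_etaColemanPoitouTate_zeta`, 21363 = h134, 21364 =
h12). HONEST FRAMING: BSD is not proved by any of this; every theorem below is either pure module algebra
or CONDITIONAL on named Literature facts displayed as hypotheses; the crux stays settled-by-citation; this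
file closes NOTHING (`--supports 20445 --as helper`). PARTITION (D-0054): EXCLUDED-DOMAIN non-CM ∪ CM
additive `p` · B4 Gss2 (`e = 2`, `p ≥ 5`).

## What is proved

* §1 `KatoSideRank.injective_iff_rank_le_one` — module algebra over a domain `R`: for `H` without zero
  smul-divisors and a functional `c : H → R` with `c s ≠ 0` for some `s`, `c` is injective iff
  `rank_R H ≤ 1`.
* §2 on the cyclotomic pin `I : Kato2004.IwasawaH1Data W p κ γ` (`𝐇¹_Γ(T_pW)`, torsion free by the TREE
  theorem `IwasawaH1Data.noZeroSMulDivisors`, rkm g7): for any `Λ`-linear `Col : 𝐇¹_Γ → Λ` non-zero at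
  some class, `Function.Injective Col ↔ Module.rank Λ 𝐇¹_Γ ≤ 1` (`coleman_injective_iff_rank_le_one`);
  with `Col z` a quadratic-branch plus function (`≠ 0`, Rohrlich) the same (`…_of_isPlus`); hence
  **Thm. 7.3 i) from Kato Thm. 12.4 BY NAME** (`coleman_injective_of_thm12_4`) and conversely **hZ's
  package gives `rank_Λ 𝐇¹_Γ(T_pW) = 1`** (`rank_eq_one_of_zeta`: `≤ 1` from `colPlus_injective`, `≥ 1`
  from `z ≠ 0`), i.e. the rank clause of `Kato2004.thm12_4` and the (NT) statement `Nontrivial 𝐇¹_Γ`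
  (`nontrivial_of_zeta`) on every frame of hZ; at the fact level `rank_iwasawaH1_eq_one_twist_of_zeta`.

## Why (census line, complements `…PlusKatoDivisibilityCor72OfThm134.lean`)

Field anatomy of hZ on the crux's rows after g7: `isTorsion_fine` — DERIVABLE (Cor72 file);
`colPlus_injective` / `colMinus_injective` — each EQUIVALENT on the pin to `rank_Λ 𝐇¹_Γ ≤ 1` = Kato 12.4
(2) (this file; Euler-system-borne in print, §13), so a swap and not a reduction; the remaining fields
`z` + `isEulerSystemClass_z` (Kato's construction, Ex. 13.3), `colPlus`/`colMinus` with
`isPlus`/`isMinus` (Coleman maps (6.13)/(6.15) + explicit reciprocity, Thm. 6.3) and `exact_plus`/`exact_minus`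
((7.21): Poitou–Tate along the tower + Thm. 6.2) are the IRREDUCIBLE core — none has a tree object
behind it (no local Iwasawa cohomology `H¹_Iw(k_∞, T)`, no Coleman map, no `𝐇²`). Consequence recorded
for the planner: on K8 rows the held fact `Kato2004.thm12_4` (load-bearing in other cells) is implied,
rank clause and (NT), by hZ.

References: [Kobayashi2003] Thm. 7.3 i) (p. 13), Thm. 5.1 iii) and Remark 5.3 i) (pp. 9–10), Thm. 6.3
(p. 11), Thm. 3.2 (p. 7); [Kato2004Asterisque] Thm. 12.4 (2) (p. 221), §13; [RohrlichInventiones1984].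
-/

noncomputable section

set_option linter.dupNamespace false

open scoped Classical

open CongruenceSubgroup Field WeierstrassCurve
open Literature.NumberTheory.EllipticCurves
open Literature.NumberTheory.EllipticCurves.ModularForms
open Literature.NumberTheory.GaloisRepresentations
open Summit.BirchSwinnertonDyer.Rank1Residual.Additive hiding EtaSignedSelmerDualData

namespace Summit.BirchSwinnertonDyer.BirchSwinnertonDyer.Theorems

namespace KatoSideRank

/-! ## §1 Module algebra: a non-zero functional on a torsion-free module is injective iff the rank is `≤ 1` -/

section Algebra

variable {R : Type*} [CommRing R] [IsDomain R] {H : Type*} [AddCommGroup H] [_root_.Module R H]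

/-- Over a domain `R`, for a module `H` without zero smul-divisors and an `R`-linear functional
`c : H → R` with `c s ≠ 0` for some `s ∈ H`: `c` is injective iff `rank_R H ≤ 1` (`⟹`: `H ↪ R`;
`⟸`: any `x` is dependent with `s`, `a x + b s = 0`, `(a, b) ≠ 0`; applying `c` to `x ∈ ker c` gives
`b·c(s) = 0`, `b = 0`, `a ≠ 0`, `a x = 0`, `x = 0`). [folklore] -/
theorem injective_iff_rank_le_one [NoZeroSMulDivisors R H] (c : H →ₗ[R] R) {s : H} (hs : c s ≠ 0) :
    Function.Injective c ↔ Module.rank R H ≤ 1 := by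
  constructor
  · intro hc
    have h := c.lift_rank_le_of_injective hc
    rwa [Module.rank_self, Cardinal.lift_one, Cardinal.lift_le_one_iff] at h
  · intro hrk
    rw [injective_iff_map_eq_zero]
    intro x hx
    have hdep : ∃ a b : R, (a ≠ 0 ∨ b ≠ 0) ∧ a • x + b • s = 0 := by
      by_contra hcon
      push Not at hcon
      have hli : LinearIndependent R ![x, s] := by
        rw [LinearIndependent.pair_iff]
        intro a b hab
        by_contra hne
        exact hcon a b (not_and_or.mp hne) hab
      have h2 : (2 : Cardinal) ≤ Module.rank R H := by
        simpa using hli.cardinal_lift_le_rank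
      have h21 : (2 : Cardinal) ≤ 1 := h2.trans hrk
      norm_num at h21
    obtain ⟨a, b, hab, h0⟩ := hdep
    have hb : b = 0 := by
      have h1 := congrArg c h0
      rw [map_add, map_smul, map_smul, hx, smul_zero, zero_add, map_zero, smul_eq_mul] at h1
      exact (mul_eq_zero.mp h1).resolve_right hs
    subst hb
    have ha : a ≠ 0 := hab.resolve_right (fun h => h rfl)
    rw [zero_smul, add_zero] at h0
    exact (smul_eq_zero.mp h0).resolve_left ha

end Algebra

/-! ## §2 On the cyclotomic pin `𝐇¹_Γ(T_pW)`: Thm. 7.3 i) ⟺ `rank_Λ 𝐇¹_Γ ≤ 1`; hZ ⟹ `rank_Λ 𝐇¹_Γ = 1` -/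

section Pin

variable {p : ℕ} [Fact p.Prime] {K₀ : Type} [Field K₀] [NumberField K₀]
  [(galRange (K := ℚ) K₀).Normal] {η : absoluteGaloisGroup ℚ →* ℤˣ}
  {V : WeierstrassCurve ℚ} [V.IsElliptic] [V.IsGloballyMinimal] {N : ℕ} [NeZero N]
  {f : CuspForm (Gamma0 N) 2} {ϖ : ℚ} {κ : ZpExtension ℚ p} {γ : absoluteGaloisGroup ℚ}
  {W : WeierstrassCurve ℚ} [W.IsElliptic] [ContinuousSMul ℤ_[p] (W.tateModule p)]
  [Module.Free ℤ_[p] (W.tateModule p)] [Module.Finite ℤ_[p] (W.tateModule p)]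
  {I : Kato2004.IwasawaH1Data W p κ γ} {FB : W.FineSelmerDualData κ γ}

omit [Module.Free ℤ_[p] (W.tateModule p)] [Module.Finite ℤ_[p] (W.tateModule p)] in
/-- **A `Λ`-linear `Col : 𝐇¹_Γ(T_pW) → Λ` non-zero at some class is injective iff `rank_Λ 𝐇¹_Γ(T_pW) ≤ 1`**
(`𝐇¹_Γ` is torsion free: tree theorem `IwasawaH1Data.noZeroSMulDivisors`). [cite: Kato2004Asterisque, Thm. 12.4 (2) (p. 221)]
[cite: Kobayashi2003, Thm. 7.3 i) (p. 13)] -/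
theorem coleman_injective_iff_rank_le_one (hγ : κ.IsTopGenerator γ) (I : Kato2004.IwasawaH1Data W p κ γ)
    (Col : I.H →ₗ[IwasawaAlgebra p] IwasawaAlgebra p) {z : I.H} (hCz : Col z ≠ 0) :
    Function.Injective Col ↔ Module.rank (IwasawaAlgebra p) I.H ≤ 1 :=
  haveI := I.noZeroSMulDivisors hγ
  injective_iff_rank_le_one Col hCz

omit [Module.Free ℤ_[p] (W.tateModule p)] [Module.Finite ℤ_[p] (W.tateModule p)] in
/-- **Thm. 7.3 i) ⟺ Kato 12.4 (2) (upper half) on the pin, in hZ's currency**: if `Col z` is a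
quadratic-branch plus function `L_p⁺(V, η, X)` (non-zero by Rohrlich, tree theorem
`IsQuadraticBranchPlusLFunction.ne_zero_of_isNewformOf`), then `Col` is injective iff
`rank_Λ 𝐇¹_Γ(T_pW) ≤ 1`. [cite: Kobayashi2003, Thm. 7.3 i) (p. 13), Thm. 6.3 (p. 11), Thm. 3.2 (p. 7)]
[cite: Kato2004Asterisque, Thm. 12.4 (2) (p. 221)] -/
theorem coleman_injective_iff_rank_le_one_of_isPlus (hp2 : p ≠ 2) (hgood : V.HasGoodReductionAtPrime p)
    (hf : IsNewformOf V f)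
    (hϖ : if Even (p / 2) then (ϖ : ℝ) * V.realPeriodRat = plusPeriod f
      else (ϖ : ℝ) * V.imaginaryPeriodRat = minusPeriod f)
    (hγ : κ.IsTopGenerator γ) (I : Kato2004.IwasawaH1Data W p κ γ)
    (Col : I.H →ₗ[IwasawaAlgebra p] IwasawaAlgebra p) (z : I.H)
    (hplus : IsQuadraticBranchPlusLFunction f p ϖ (Col z)) :
    Function.Injective Col ↔ Module.rank (IwasawaAlgebra p) I.H ≤ 1 :=
  coleman_injective_iff_rank_le_one hγ I Col
    (IsQuadraticBranchPlusLFunction.ne_zero_of_isNewformOf hp2 hf hgood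
      (EulerSystemBound.varpi_ne_zero hf hϖ) hplus)

omit [Module.Free ℤ_[p] (W.tateModule p)] [Module.Finite ℤ_[p] (W.tateModule p)] in
/-- **Kobayashi Thm. 7.3 i) from Kato Thm. 12.4 BY NAME.** Under the named fact `Kato2004.thm12_4`
(`rank_Λ 𝐇¹_Γ(T_pW) = 1` at every cyclotomic pin), ANY `Λ`-linear `Col : 𝐇¹_Γ(T_pW) → Λ` whose value at
some `z` is a quadratic-branch plus function is injective — the field `colPlus_injective` of hZ is
implied by `{thm12_4, isPlus_colPlus_z}` (Kobayashi's printed proof: Thm. 5.1 iii) + Thm. 6.3 + Rohrlich).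
CONDITIONAL on `thm12_4`. [cite: Kobayashi2003, Thm. 7.3 i) and its proof (p. 13), Thm. 5.1 iii) (p. 9)]
[cite: Kato2004Asterisque, Thm. 12.4 (2) (p. 221)] -/
theorem coleman_injective_of_thm12_4 (h124 : Kato2004.thm12_4) (hp2 : p ≠ 2)
    (hgood : V.HasGoodReductionAtPrime p) (hf : IsNewformOf V f)
    (hϖ : if Even (p / 2) then (ϖ : ℝ) * V.realPeriodRat = plusPeriod f
      else (ϖ : ℝ) * V.imaginaryPeriodRat = minusPeriod f)
    (hκ : κ.IsCyclotomic) (hγ : κ.IsTopGenerator γ) (I : Kato2004.IwasawaH1Data W p κ γ)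
    (Col : I.H →ₗ[IwasawaAlgebra p] IwasawaAlgebra p) (z : I.H)
    (hplus : IsQuadraticBranchPlusLFunction f p ϖ (Col z)) : Function.Injective Col :=
  (coleman_injective_iff_rank_le_one_of_isPlus hp2 hgood hf hϖ hγ I Col z hplus).mpr
    (Kato2004.thm12_4.isTorsionFree_and_rank_le_one h124 W p hκ hγ I).2

/-- **hZ's package gives the upper half of Kato 12.4 (2): `rank_Λ 𝐇¹_Γ(T_pW) ≤ 1`** (from
`colPlus_injective` and `Col⁺ z ≠ 0`). [cite: Kobayashi2003, Thm. 7.3 i) (p. 13)] [cite: Kato2004Asterisque, Thm. 12.4 (2) (p. 221)] -/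
theorem rank_le_one_of_zeta (E : Kobayashi2003.EtaColemanPoitouTateZetaData p K₀ η V f ϖ κ γ W I FB)
    (hp2 : p ≠ 2) (hgood : V.HasGoodReductionAtPrime p) (hf : IsNewformOf V f)
    (hϖ : if Even (p / 2) then (ϖ : ℝ) * V.realPeriodRat = plusPeriod f
      else (ϖ : ℝ) * V.imaginaryPeriodRat = minusPeriod f)
    (hγ : κ.IsTopGenerator γ) : Module.rank (IwasawaAlgebra p) I.H ≤ 1 :=
  (coleman_injective_iff_rank_le_one_of_isPlus hp2 hgood hf hϖ hγ I E.colPlus E.z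
    E.isPlus_colPlus_z).mp E.colPlus_injective

/-- **hZ's package gives (NT) «`𝐇¹_Γ(T_pW) ≠ 0`»** (`z ≠ 0`, lane B `EulerSystemBound.z_ne_zero`).
[cite: Kobayashi2003, Thm. 6.3 (p. 11)] [cite: Kato2004Asterisque, Thm. 12.4 (2) (p. 221)] -/
theorem nontrivial_of_zeta (E : Kobayashi2003.EtaColemanPoitouTateZetaData p K₀ η V f ϖ κ γ W I FB)
    (hp2 : p ≠ 2) (hgood : V.HasGoodReductionAtPrime p) (hf : IsNewformOf V f)
    (hϖ : if Even (p / 2) then (ϖ : ℝ) * V.realPeriodRat = plusPeriod f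
      else (ϖ : ℝ) * V.imaginaryPeriodRat = minusPeriod f) : Nontrivial I.H :=
  nontrivial_of_ne E.z 0 (EulerSystemBound.z_ne_zero E hp2 hgood hf hϖ)

/-- **hZ's package gives Kato Thm. 12.4 (2)'s rank clause: `rank_Λ 𝐇¹_Γ(T_pW) = 1`** (`≤ 1` from
Thm. 7.3 i) and `Col⁺ z ≠ 0`; `≥ 1` from `z ≠ 0` in the torsion-free `𝐇¹_Γ`, tree theorem
`IwasawaH1Data.isTorsionFree`). CONDITIONAL on the existence of `E` (the fact hZ).
[cite: Kato2004Asterisque, Thm. 12.4 (2) (p. 221)] [cite: Kobayashi2003, Thm. 7.3 i) (p. 13), Thm. 5.1 iii) (p. 9)] -/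
theorem rank_eq_one_of_zeta (E : Kobayashi2003.EtaColemanPoitouTateZetaData p K₀ η V f ϖ κ γ W I FB)
    (hp2 : p ≠ 2) (hgood : V.HasGoodReductionAtPrime p) (hf : IsNewformOf V f)
    (hϖ : if Even (p / 2) then (ϖ : ℝ) * V.realPeriodRat = plusPeriod f
      else (ϖ : ℝ) * V.imaginaryPeriodRat = minusPeriod f)
    (hγ : κ.IsTopGenerator γ) : Module.rank (IwasawaAlgebra p) I.H = 1 := by
  haveI := I.isTorsionFree hγ
  haveI := nontrivial_of_zeta E hp2 hgood hf hϖ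
  exact le_antisymm (rank_le_one_of_zeta E hp2 hgood hf hϖ hγ) (Cardinal.one_le_iff_pos.mpr rank_pos)

end Pin

/-! ## §3 Fact level: hZ ⟹ the rank clause of `Kato2004.thm12_4` for every twist model `W` -/

section ByName

variable {p : ℕ} [Fact p.Prime]

/-- **`hZ` ⟹ `rank_Λ 𝐇¹_Γ(T_pW) = 1` and `𝐇¹_Γ(T_pW)` torsion free, finitely generated** — the first two
clauses of the named fact `Kato2004.thm12_4`, for every model `W` of the `p*`-twist of a globally minimal
`V` with good reduction and `a_p = 0` at an odd `p` (CM or not, any image), at every cyclotomic pin lying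
under `ℚ(μ_p)`'s Galois group as in hZ's frame; (12.2.1) and torsion-freeness being tree theorems.
So on the K8 rows the rank content of `thm12_4` is INSIDE hZ. CONDITIONAL on hZ.
[cite: Kato2004Asterisque, Thm. 12.4 (2) (p. 221), §12.2 (12.2.1) (p. 220)] [cite: Kobayashi2003, Thm. 7.3 i) (p. 13), Thm. 6.3 (p. 11)] -/
theorem rank_iwasawaH1_eq_one_twist_of_zeta
    (hZ : Kobayashi2003.thm62_63_73_etaColemanPoitouTate_zeta)
    (K₀ : Type) [Field K₀] [NumberField K₀] [IsCyclotomicExtension {p} ℚ K₀]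
    [(galRange (K := ℚ) K₀).Normal] (η : absoluteGaloisGroup ℚ →* ℤˣ)
    (hηK : ∀ σ ∈ galRange (K := ℚ) K₀, η σ = 1) (hη1 : η ≠ 1)
    (V : WeierstrassCurve ℚ) [V.IsElliptic] [V.IsGloballyMinimal] {N : ℕ} [NeZero N]
    {f : CuspForm (Gamma0 N) 2} (hp2 : p ≠ 2) (hgood : V.HasGoodReductionAtPrime p)
    (hap : V.frobeniusTrace p = 0) (hf : IsNewformOf V f) (ϖ : ℚ)
    (hϖ : if Even (p / 2) then (ϖ : ℝ) * V.realPeriodRat = plusPeriod f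
      else (ϖ : ℝ) * V.imaginaryPeriodRat = minusPeriod f)
    (κ : ZpExtension ℚ p) (γ : absoluteGaloisGroup ℚ) (hκ : κ.IsCyclotomic) (hγ : κ.IsTopGenerator γ)
    (hγK : γ ∈ galRange (K := ℚ) K₀) (hγc : IsCyclotomicVariable p γ)
    (W : WeierstrassCurve ℚ) [W.IsElliptic] [ContinuousSMul ℤ_[p] (W.tateModule p)]
    [Module.Free ℤ_[p] (W.tateModule p)] [Module.Finite ℤ_[p] (W.tateModule p)]
    (C : VariableChange ℚ) (hC : C • W.quadraticTwist ((-1) ^ (p / 2) * p) = V)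
    (I : Kato2004.IwasawaH1Data W p κ γ) :
    Module.Finite (IwasawaAlgebra p) I.H ∧
      (Module.IsTorsionFree (IwasawaAlgebra p) I.H ∧ Module.rank (IwasawaAlgebra p) I.H = 1) := by
  obtain ⟨FB⟩ := W.nonempty_fineSelmerDualData κ hγ
  obtain ⟨E⟩ := hZ p K₀ η hηK hη1 V hp2 hgood hap hf ϖ hϖ κ γ hκ hγ hγK hγc W C hC I FB
  exact ⟨Kato2004.IwasawaH1Data.module_finite_of_isCyclotomic hκ hγ I, I.isTorsionFree hγ,
    rank_eq_one_of_zeta E hp2 hgood hf hϖ hγ⟩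

end ByName

end KatoSideRank

end Summit.BirchSwinnertonDyer.BirchSwinnertonDyer.Theorems

end
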